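import Summits.KontsevichZagierPeriods.Zeta5Search.Certificates.VIML3Defs
import HarnessLib

/-!
# ζ(5) search — brown9 LEVEL 3: kit for the transfer lemmas (cell `pub-zeta5`, certifier `cert-1`)

HONEST FRAMING: systematic search; recurrence certificates; no irrationality claim unless certified.

Small generic tools for `VIML3Transfer*.lean`: denominators as LISTS of linear factors (`denOf`) with a decidable
sufficient condition for non-vanishing under `x + 7 < 2n` (`den_ne`), the factorisations of the four pivot coefficients
(`eta02`, `NK.e10`, `thQ3`, `muQ10` are products of linear forms) with their non-vanishing at shifted arguments, and the
relation instances with caller-normalised arguments (`RK2_at`, `RNK_at`, `LK3_at`, `LNK_at`). No named facts.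
-/

namespace Summit.KontsevichZagierPeriods.Zeta5Search.Certificates

namespace VIMInner.L3

open PolyReflect
open Lean.Grind.CommRing (Expr)

/-! ### Denominators: products of powers of linear forms -/

/-- The reflected product `Π (a·n + b·x + c)^m` over a list of factors `(a, b, c, m)`. -/
def denOf : List (ℤ × ℤ × ℤ × ℕ) → Expr
  | [] => .num 1
  | (a, b, c, m) :: l => .mul (.pow (lin a b c) m) (denOf l)

/-- A factor is `good` if it is `(n + c)^m` with `c ≥ 1` or `(2n − x + c)^m` with `c ≥ −7` (non-zero when `x + 7 < 2n`). -/
def goodFac : ℤ × ℤ × ℤ × ℕ → Bool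
  | (a, b, c, _) => (a == 1 && b == 0 && decide (1 ≤ c)) || (a == 2 && b == -1 && decide (-7 ≤ c))

/-- A good factor does not vanish for `x + 7 < 2n`. -/
theorem goodFac_ne (n : ℕ) (x : ℚ) (hx : x + 7 < 2 * (n : ℚ)) (a b c : ℤ) (m : ℕ) (hf : goodFac (a, b, c, m) = true) :
    peval (.pow (lin a b c) m) (V n x) ≠ 0 := by
  rw [peval_pow, peval_lin]
  apply pow_ne_zero
  have hn0 : (0 : ℚ) ≤ n := Nat.cast_nonneg n
  simp only [goodFac, Bool.or_eq_true, Bool.and_eq_true, beq_iff_eq, decide_eq_true_eq] at hf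
  rcases hf with ⟨⟨rfl, rfl⟩, hc⟩ | ⟨⟨rfl, rfl⟩, hc⟩
  · have hc' : (1 : ℚ) ≤ c := by exact_mod_cast hc
    intro h; push_cast at h; linarith
  · have hc' : (-7 : ℚ) ≤ c := by exact_mod_cast hc
    intro h; push_cast at h; linarith

/-- **Non-vanishing of a denominator** all of whose factors are good, for `x + 7 < 2n`. -/
theorem den_ne (L : List (ℤ × ℤ × ℤ × ℕ)) (n : ℕ) (x : ℚ) (hx : x + 7 < 2 * (n : ℚ)) (hL : L.all goodFac = true) :
    peval (denOf L) (V n x) ≠ 0 := by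
  induction L with
  | nil => rw [denOf, peval_num]; norm_num
  | cons f l ih =>
    obtain ⟨a, b, c, m⟩ := f
    rw [List.all_cons, Bool.and_eq_true] at hL
    rw [denOf, peval_mul]
    exact mul_ne_zero (goodFac_ne n x hx a b c m hL.1) (ih hL.2)

/-! ### The pivots are products of linear forms -/

/-- `eta02 = (2w − x)(2w − x − 1)³`. -/
theorem eta02_fac (w x : ℚ) : eta02 w x = (2 * w - x) * (2 * w - x - 1) ^ 3 := by
  unfold eta02; ring

/-- `θ₃ = (2w − x)²(2w − x − 1)²(2w − x − 2)²`. -/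
theorem thQ3_fac (w x : ℚ) : thQ3 w x = (2 * w - x) ^ 2 * (2 * w - x - 1) ^ 2 * (2 * w - x - 2) ^ 2 := by
  unfold thQ3; ring

/-- `μ₁₀ = (w + 1)⁴(2w − x + 2)³(2w − x + 1)³`. -/
theorem muQ10_fac (w x : ℚ) : muQ10 w x = (w + 1) ^ 4 * (2 * w - x + 2) ^ 3 * (2 * w - x + 1) ^ 3 := by
  unfold muQ10; ring

/-- The (R-K2) pivot `κ₂(n+i, x+j) ≠ 0` when `x + j + 1 < 2(n+i)`. -/
theorem piv_ne_RK2 (n i : ℕ) (j : ℤ) (x : ℚ) (h : x + j + 1 < 2 * ((n : ℚ) + i)) :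
    peval (substs (τ i j) eKap2) (V n x) ≠ 0 := by
  rw [peval_shift n i x j _ coeff_vars.2.2.1, eKap2_peval, eta02_fac]
  push_cast
  exact mul_ne_zero (by intro h'; linarith) (pow_ne_zero _ (by intro h'; linarith))

/-- The (R-NK) pivot `e₁₀(n+i, x+j) ≠ 0` when `x + j < 2(n+i) + 1`. -/
theorem piv_ne_RNK (n i : ℕ) (j : ℤ) (x : ℚ) (h : x + j < 2 * ((n : ℚ) + i) + 1) :
    peval (substs (τ i j) eE10) (V n x) ≠ 0 := by
  rw [peval_shift n i x j _ coeff_vars.2.2.2.1, eE10_peval, NK.e10]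
  have hn0 : (0 : ℚ) ≤ n := Nat.cast_nonneg n
  push_cast
  exact mul_ne_zero (mul_ne_zero (pow_ne_zero _ (by intro h'; linarith)) (pow_ne_zero _ (by intro h'; linarith)))
    (pow_ne_zero _ (by intro h'; linarith))

/-- The (L-K3) pivot `θ₃(n+i, x+j) ≠ 0` when `x + j + 2 < 2(n+i)`. -/
theorem piv_ne_LK3 (n i : ℕ) (j : ℤ) (x : ℚ) (h : x + j + 2 < 2 * ((n : ℚ) + i)) :
    peval (substs (τ i j) eTh3) (V n x) ≠ 0 := by
  rw [peval_shift n i x j _ coeff_vars.2.2.2.2.2.2.2.2.2.1, eTh3_peval, thQ3_fac]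
  push_cast
  exact mul_ne_zero (mul_ne_zero (pow_ne_zero _ (by intro h'; linarith)) (pow_ne_zero _ (by intro h'; linarith)))
    (pow_ne_zero _ (by intro h'; linarith))

/-- The (L-NK) pivot `μ₁₀(n+i, x+j) ≠ 0` when `x + j < 2(n+i) + 1`. -/
theorem piv_ne_LNK (n i : ℕ) (j : ℤ) (x : ℚ) (h : x + j < 2 * ((n : ℚ) + i) + 1) :
    peval (substs (τ i j) eMu10) (V n x) ≠ 0 := by
  rw [peval_shift n i x j _ coeff_vars.2.2.2.2.2.2.2.2.2.2.1, eMu10_peval, muQ10_fac]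
  have hn0 : (0 : ℚ) ≤ n := Nat.cast_nonneg n
  push_cast
  exact mul_ne_zero (mul_ne_zero (pow_ne_zero _ (by intro h'; linarith)) (pow_ne_zero _ (by intro h'; linarith)))
    (pow_ne_zero _ (by intro h'; linarith))

/-! ### Relation instances with caller-normalised arguments -/

/-- (R-K2) at `(n+i, x+j)` with caller-normalised arguments. -/
theorem RK2_at (n : ℕ) (hn : 3 ≤ n) (i : ℕ) (j : ℤ) (x : ℚ) (m : ℕ) (y0 y1 y2 : ℚ) (hm : m = n + i)
    (h0 : y0 = x + j) (h1 : y1 = x + j + 1) (h2 : y2 = x + j + 2) :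
    peval (substs (τ i j) eKap0) (V n x) * Rsum m y0 + peval (substs (τ i j) eKap1) (V n x) * Rsum m y1
      + peval (substs (τ i j) eKap2) (V n x) * Rsum m y2 = 0 := by
  subst hm h0 h1 h2; exact RK2_inst n hn i j x

/-- (R-NK) at `(n+i, x+j)` with caller-normalised arguments. -/
theorem RNK_at (n : ℕ) (hn : 3 ≤ n) (i : ℕ) (j : ℤ) (x : ℚ) (m m1 : ℕ) (y0 y1 : ℚ) (hm : m = n + i) (hm1 : m1 = n + i + 1)
    (h0 : y0 = x + j) (h1 : y1 = x + j + 1) :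
    peval (substs (τ i j) eE10) (V n x) * Rsum m1 y0 + peval (substs (τ i j) eE00) (V n x) * Rsum m y0
      + peval (substs (τ i j) eE01) (V n x) * Rsum m y1 = 0 := by
  subst hm hm1 h0 h1; exact RNK_inst n hn i j x

/-- (L-K3) at `(n+i, x+j)` with caller-normalised arguments. -/
theorem LK3_at {n : ℕ} (hK : ∀ m, n ≤ m → LK3At m) (i : ℕ) (j : ℤ) (x : ℚ) (m : ℕ) (y0 y1 y2 y3 : ℚ) (hm : m = n + i)
    (h0 : y0 = x + j) (h1 : y1 = x + j + 1) (h2 : y2 = x + j + 2) (h3 : y3 = x + j + 3) :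
    peval (substs (τ i j) eTh0) (V n x) * Lsum m y0 + peval (substs (τ i j) eTh1) (V n x) * Lsum m y1
      + peval (substs (τ i j) eTh2) (V n x) * Lsum m y2 + peval (substs (τ i j) eTh3) (V n x) * Lsum m y3 = 0 := by
  subst hm h0 h1 h2 h3; exact LK3_inst hK i j x

/-- (L-NK) at `(n+i, x+j)` with caller-normalised arguments. -/
theorem LNK_at {n : ℕ} (hN : ∀ m, n ≤ m → LNKAt m) (i : ℕ) (j : ℤ) (x : ℚ) (m m1 : ℕ) (y0 y1 y2 : ℚ) (hm : m = n + i)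
    (hm1 : m1 = n + i + 1) (h0 : y0 = x + j) (h1 : y1 = x + j + 1) (h2 : y2 = x + j + 2) :
    peval (substs (τ i j) eMu10) (V n x) * Lsum m1 y0 + peval (substs (τ i j) eMu00) (V n x) * Lsum m y0
      + peval (substs (τ i j) eMu01) (V n x) * Lsum m y1 + peval (substs (τ i j) eMu02) (V n x) * Lsum m y2 = 0 := by
  subst hm hm1 h0 h1 h2; exact LNK_inst hN i j x

end VIMInner.L3

end Summit.KontsevichZagierPeriods.Zeta5Search.Certificates
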